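import Mathlib.Topology.Algebra.Module.FiniteDimension
import Mathlib.Topology.Algebra.OpenSubgroup
import Mathlib.Topology.Algebra.Valued.NormedValued
import Literature.NumberTheory.Automorphic.QuaternionAlgebraEmbeddingProofs
import Literature.NumberTheory.QuadraticForms.QuadraticNormIndexCount
import Literature.NumberTheory.QuadraticForms.SquareClassIndex
import HarnessLib

/-!
# The local norm index is `2` at every place, without class field theory (O'Meara 63:13a);
# consequences for quaternion algebras over number fields

Topic `NumberTheory/QuadraticForms`; namespace `Literature` (and `Literature.Automorphic` for the final
assemblies); all declarations fully proved. For a number field `K`, a finite place `v` — dyadic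
places included — and a non-square `a ∈ K_vˣ`:

  `index_quadraticNormSubgroup_adicCompletion_eq_two` : `(K_vˣ : N(K_v(√a)ˣ)) = 2`,

where `N(K_v(√a)ˣ) = quadraticNormSubgroup K_v a` (`QuadraticNormIndex.lean`). This is O'Meara
63:13a (the quadratic case of the fundamental equality `[Fˣ : N Eˣ] = [E : F]` of local class
field theory); the non-dyadic case was proved in `QuadraticNormIndexLocal.lean`, and
`QuadraticNormLocalCFT.lean` derives all cases from the named fact `index_normSubgroup_eq_finrank`.
Here the proof is elementary and complete, by counting square classes:

* `QuadraticNormIndexCount.lean`: `(Fˣ : N(Eˣ)) · 2 · (Eˣ : Eˣ²) = (Fˣ : Fˣ²)²` for `E = F(√a)`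
  (Hilbert 90);
* `SquareClassIndex.lean` (O'Meara 63:9): `(Fˣ : Fˣ²) = 4 |𝒪_F / 2𝒪_F|` for every completion `F`
  of a number field;
* this file: `(Eˣ : Eˣ²) = 4 |𝒪_F/2𝒪_F|²` for `E = K_v(√a)`, by realising `E` as a completion:
  1. `exists_eq_algebraMap_mul_sq` — **global integral representatives of local square classes**
     (density of `K` in `K_v` and the Local Square Theorem in the form
     `1 + 4π𝒪_v ⊆ K_v²`, `map_powMonoidHom_two_congr`): `a = b c²` with `b ∈ K`, `v(b) ≤ 1`;
  2. `exists_continuous_ringHom_adicCompletion`, `valued_le_one_of_ringHom` — for `L = K(√b)`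
     (Mathlib `QuadraticAlgebra K b 0`, a number field) and a place `w ∣ v` of `L`, the continuous
     extension `f : K_v → L_w` of `K → L` (Mathlib `uniformContinuous_algebraMap_liesOver`) and
     `f(𝒪_v) ⊆ 𝒪_w`;
  3. `finrank_adicCompletion_le`, `exists_ringEquiv_quadraticAlgebra_adicCompletion` —
     `[L_w : K_v] ≤ [L : K] = 2` (the dense-range argument of Mathlib's
     `NumberField.Completion.FinitePlace`) and hence **`K_v(√b) ≃ L_w`** (`ω ↦ √b`);
  4. `natCard_integer_quotient_two_eq_sq` — **`|𝒪_w / 2𝒪_w| = |𝒪_v / 2𝒪_v|²`**: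
     `M = f(𝒪_v) ⊕ f(𝒪_v)√b` is an open subgroup of finite index of the compact `𝒪_w`
     (`L_w ≅ K_v²` topologically, Mathlib `LinearEquiv.toContinuousLinearEquiv`), and
     `(𝒪_w : 2𝒪_w) = (M : 2M)` since `x ↦ 2x` is injective (index calculus); this replaces the
     ramification theory `e f = 2` of `L_w/K_v`, unavailable at the pin;
  5. `index_quadraticNormSubgroup_eq_two_of_algebraMap`, and the general case by 1.

Consequences (`Literature.Automorphic`, closing the decomposition of Vignéras III Thm. 3.1 in
`Literature/NumberTheory/Automorphic/QuaternionAlgebra{Classification,Hasse,Embedding,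
Uniqueness,LocalUniqueness,EmbeddingProofs}`):

* `adicCompletion_exists_hilbertSymbol_eq_neg_one_holds` — the named fact of
  `QuadraticNormIndex.lean` (O'Meara 63:13) holds;
* `nonempty_algEquiv_adicCompletion_of_division_holds` — the named fact of
  `QuaternionAlgebraClassification` (Vignéras II Thm. 1.1: uniqueness of the quaternion division
  algebra over `K_v`) holds;
* `exists_sq_eq_of_not_isSquare_ramified_of_hasseNorm`,
  `nonempty_algEquiv_of_ramifiedPlaces_eq_of_hasseNorm` — Vignéras III Thm. 3.8 (1) and
  **III Thm. 3.1 (uniqueness of quaternion algebras with given ramification) follow from Hasse's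
  norm theorem for quadratic extensions of number fields alone**
  (`hilbertSymbol_eq_one_of_forall_completions`, Vignéras III Cor. 3.4).

## References

* O. T. O'Meara, *Introduction to quadratic forms*, Grundlehren 117, Springer (1963), §63A
  (63:1, 63:9), §63B (63:13, 63:13a).
* M.-F. Vignéras, *Arithmétique des algèbres de quaternions*, LNM 800 (1980), Ch. II §1 Thm. 1.1,
  Lemme 1.8; Ch. III §3 Thm. 3.1, Cor. 3.4, Thm. 3.8.
-/

noncomputable section

open NumberField IsDedekindDomain Valued

namespace Literature.NumberTheory.QuadraticForms

section CompletionMap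

variable (K L : Type*) [Field K] [NumberField K] [Field L] [NumberField L] [Algebra K L]
variable (v : HeightOneSpectrum (𝓞 K)) (w : HeightOneSpectrum (𝓞 L)) [w.asIdeal.LiesOver v.asIdeal]

/-- For a finite place `w` of `L` over `v` of `K`: a **continuous** ring homomorphism
`K_v →+* L_w` extending `K → L` (Mathlib `uniformContinuous_algebraMap_liesOver` and
`UniformSpace.Completion.mapRingHom`; cf. `exists_ringHom_adicCompletion_algebraMap` of
`QuaternionAlgebraEmbeddingProofs`, without the continuity). [folklore] -/
theorem exists_continuous_ringHom_adicCompletion :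
    ∃ f : v.adicCompletion K →+* w.adicCompletion L, Continuous f ∧
      ∀ x : K, f (algebraMap K (v.adicCompletion K) x) =
        algebraMap L (w.adicCompletion L) (algebraMap K L x) := by
  have huc := HeightOneSpectrum.uniformContinuous_algebraMap_liesOver K L v w
  let f : v.adicCompletion K →+* w.adicCompletion L :=
    (HeightOneSpectrum.adicCompletion.equiv L w).symm.toRingHom.comp <|
      (UniformSpace.Completion.mapRingHom
        (algebraMap (WithVal (v.valuation K)) (WithVal (w.valuation L))) huc.continuous).comp
      (HeightOneSpectrum.adicCompletion.equiv K v).toRingHom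
  refine ⟨f, ?_, fun x ↦ ?_⟩
  · exact (HeightOneSpectrum.adicCompletion.continuous_ofCompletion L w).comp
      (UniformSpace.Completion.continuous_map.comp
        (HeightOneSpectrum.adicCompletion.continuous_toCompletion K v))
  apply HeightOneSpectrum.adicCompletion.ext
  simp only [f, RingHom.coe_comp, Function.comp_apply, RingEquiv.toRingHom_eq_coe,
    RingEquiv.coe_toRingHom, UniformSpace.Completion.mapRingHom_apply]
  rw [show ∀ z, ((HeightOneSpectrum.adicCompletion.equiv L w).symm z).toCompletion = z from
    fun z ↦ rfl]
  rw [show (HeightOneSpectrum.adicCompletion.equiv K v) (algebraMap K (v.adicCompletion K) x) =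
      ((WithVal.toVal (v.valuation K) x : WithVal (v.valuation K)) : (v.valuation K).Completion)
    from rfl]
  rw [UniformSpace.Completion.map_coe huc]
  simp [WithVal.algebraMap_left_apply, WithVal.algebraMap_right_apply,
    HeightOneSpectrum.algebraMap_adicCompletion_toCompletion,
    UniformSpace.Completion.algebraMap_def]

/-- A continuous extension `f : K_v →+* L_w` of `K → L` maps `𝒪_v` into `𝒪_w`: the set of
`x ∈ K_v` with `x ∉ 𝒪_v` or `f x ∈ 𝒪_w` is closed (`𝒪_v` is open, `𝒪_w` closed, `f`
continuous) and contains the dense image of `K` (`w(y) = v(y)^{e(w|v)}` on `K`, Mathlib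
`valuation_liesOver`). [folklore] -/
theorem valued_le_one_of_ringHom {f : v.adicCompletion K →+* w.adicCompletion L}
    (hf : Continuous f)
    (hfK : ∀ x : K, f (algebraMap K (v.adicCompletion K) x) =
      algebraMap L (w.adicCompletion L) (algebraMap K L x))
    {x : v.adicCompletion K} (hx : Valued.v x ≤ 1) : Valued.v (f x) ≤ 1 := by
  -- the closed set `{x | x ∉ 𝒪_v ∨ f x ∈ 𝒪_w}`
  have hclosed : IsClosed {x : v.adicCompletion K | ¬ Valued.v x ≤ 1 ∨ Valued.v (f x) ≤ 1} := by
    have h1 : IsClosed {x : v.adicCompletion K | ¬ Valued.v x ≤ 1} := by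
      rw [← isOpen_compl_iff]
      convert (Valued.isOpen_integer (v.adicCompletion K)) using 1
      ext x; simp [Valuation.mem_integer_iff]
    have h2 : IsClosed {x : v.adicCompletion K | Valued.v (f x) ≤ 1} :=
      (Valued.isClosed_integer (w.adicCompletion L)).preimage hf
    exact h1.union h2
  have hdense := HeightOneSpectrum.denseRange_algebraMap (K := K) v
  have hall : ∀ y : v.adicCompletion K, ¬ Valued.v y ≤ 1 ∨ Valued.v (f y) ≤ 1 := by
    intro y
    refine hdense.induction_on (p := fun y ↦ ¬ Valued.v y ≤ 1 ∨ Valued.v (f y) ≤ 1) y hclosed ?_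
    intro k
    by_cases hk : Valued.v (algebraMap K (v.adicCompletion K) k) ≤ 1
    · right
      have hvk : Valued.v (algebraMap K (v.adicCompletion K) k) = v.valuation K k :=
        HeightOneSpectrum.valuedAdicCompletion_eq_valuation' v k
      have hwk : Valued.v (algebraMap L (w.adicCompletion L) (algebraMap K L k)) =
          w.valuation L (algebraMap K L k) :=
        HeightOneSpectrum.valuedAdicCompletion_eq_valuation' w _
      rw [hfK, hwk, ← HeightOneSpectrum.valuation_liesOver L v w]
      rw [hvk] at hk
      exact pow_le_one' hk _
    · exact Or.inl hk
  rcases hall x with h | h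
  · exact absurd hx h
  · exact h

end CompletionMap

section LocalIso

open scoped TensorProduct Valued

variable (K L : Type*) [Field K] [NumberField K] [Field L] [NumberField L] [Algebra K L]
variable (v : HeightOneSpectrum (𝓞 K)) (w : HeightOneSpectrum (𝓞 L))

/-- **`[L_w : K_v] ≤ [L : K]`** for a continuous extension `f : K_v →+* L_w` of `K → L`: with the
`K_v`-algebra structure defined by `f`, the multiplication map `K_v ⊗_K L → L_w` has dense range
(it contains `L`) and finite-dimensional, hence closed, range, so it is onto (the argument of
Mathlib's instance `Module.Finite K_v L_w`, `NumberField.Completion.FinitePlace`). [folklore] -/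
theorem finrank_adicCompletion_le {f : v.adicCompletion K →+* w.adicCompletion L}
    (hf : Continuous f)
    (hfK : ∀ x : K, f (algebraMap K (v.adicCompletion K) x) =
      algebraMap L (w.adicCompletion L) (algebraMap K L x)) :
    letI : Algebra (v.adicCompletion K) (w.adicCompletion L) := f.toAlgebra
    Module.finrank (v.adicCompletion K) (w.adicCompletion L) ≤ Module.finrank K L := by
  letI : Algebra (v.adicCompletion K) (w.adicCompletion L) := f.toAlgebra
  haveI : IsScalarTower K (v.adicCompletion K) (w.adicCompletion L) :=
    IsScalarTower.of_algebraMap_eq fun x ↦ by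
      rw [RingHom.algebraMap_toAlgebra, hfK, ← IsScalarTower.algebraMap_apply]
  haveI : ContinuousSMul (v.adicCompletion K) (w.adicCompletion L) :=
    ⟨(hf.comp continuous_fst).mul continuous_snd⟩
  let Φ : (v.adicCompletion K) ⊗[K] L →ₗ[v.adicCompletion K] w.adicCompletion L :=
    (Algebra.TensorProduct.lift (Algebra.algHom _ _ _) (Algebra.algHom K L _)
      (fun _ _ ↦ Commute.all _ _)).toLinearMap
  have h_dense : DenseRange Φ := by
    apply (w.denseRange_algebraMap L).mono
    rintro _ ⟨l, rfl⟩
    exact ⟨1 ⊗ₜ l, by simp [Φ, Algebra.algHom]⟩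
  have hsurj : Function.Surjective Φ := by
    rw [← Set.range_eq_univ, ← Φ.coe_range, ← Φ.range.closed_of_finiteDimensional.closure_eq]
    exact h_dense.closure_range
  calc Module.finrank (v.adicCompletion K) (w.adicCompletion L)
      = Module.finrank (v.adicCompletion K) (LinearMap.range Φ) := by
          rw [LinearMap.range_eq_top.mpr hsurj, finrank_top]
    _ ≤ Module.finrank (v.adicCompletion K) ((v.adicCompletion K) ⊗[K] L) :=
          LinearMap.finrank_range_le Φ
    _ = Module.finrank K L := Module.finrank_baseChange

/-- **The completion of a quadratic field is the local quadratic algebra**: let `L ⊇ K` be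
number fields with `[L : K] = 2`, `r ∈ L` with `r² = a₀ ∈ K`, `w ∣ v` finite places and `a₀` not a
square in `K_v`; then for a continuous extension `f : K_v →+* L_w` of `K → L` there is a ring
isomorphism `e : K_v(√a₀) = QuadraticAlgebra K_v a₀ 0 ≃+* L_w` extending `f` with `e ω = r`:
the algebra map `ω ↦ r` (Mathlib `QuadraticAlgebra.lift`) is injective (source a field) and onto
by dimensions, `[L_w : K_v] ≤ 2` (`finrank_adicCompletion_le`). (Vignéras II §1 Lemme 1.8 /
III §3: `L_w = K_v ⊗ L` when `v` does not split.) [folklore] -/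
theorem exists_ringEquiv_quadraticAlgebra_adicCompletion
    {f : v.adicCompletion K →+* w.adicCompletion L} (hf : Continuous f)
    (hfK : ∀ x : K, f (algebraMap K (v.adicCompletion K) x) =
      algebraMap L (w.adicCompletion L) (algebraMap K L x))
    (hL : Module.finrank K L = 2) {a₀ : K} {r : L} (hr : r * r = algebraMap K L a₀)
    [Fact (∀ x : v.adicCompletion K, x ^ 2 ≠ algebraMap K (v.adicCompletion K) a₀ + 0 * x)] :
    ∃ e : QuadraticAlgebra (v.adicCompletion K) (algebraMap K (v.adicCompletion K) a₀) 0 ≃+*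
        w.adicCompletion L,
      (∀ x, e (algebraMap (v.adicCompletion K) _ x) = f x) ∧
        e QuadraticAlgebra.omega = algebraMap L (w.adicCompletion L) r := by
  letI : Algebra (v.adicCompletion K) (w.adicCompletion L) := f.toAlgebra
  haveI : IsScalarTower K (v.adicCompletion K) (w.adicCompletion L) :=
    IsScalarTower.of_algebraMap_eq fun x ↦ by
      rw [RingHom.algebraMap_toAlgebra, hfK, ← IsScalarTower.algebraMap_apply]
  haveI : ContinuousSMul (v.adicCompletion K) (w.adicCompletion L) :=
    ⟨(hf.comp continuous_fst).mul continuous_snd⟩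
  set a := algebraMap K (v.adicCompletion K) a₀ with ha
  set E := QuadraticAlgebra (v.adicCompletion K) a 0 with hE
  -- the root of `X² - a` in `L_w`
  set ω' : w.adicCompletion L := algebraMap L (w.adicCompletion L) r with hω'
  have hω'sq : ω' * ω' = a • (1 : w.adicCompletion L) + (0 : v.adicCompletion K) • ω' := by
    rw [zero_smul, add_zero, Algebra.smul_def, mul_one, ha, ← IsScalarTower.algebraMap_apply,
      IsScalarTower.algebraMap_apply K L (w.adicCompletion L), ← hr, map_mul]
  let φ : E →ₐ[v.adicCompletion K] w.adicCompletion L := QuadraticAlgebra.lift ⟨ω', hω'sq⟩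
  have hφω : φ QuadraticAlgebra.omega = ω' := by
    change (0 : v.adicCompletion K) • (1 : w.adicCompletion L) + (1 : v.adicCompletion K) • ω' = ω'
    rw [zero_smul, one_smul, zero_add]
  have hinj : Function.Injective φ := (φ : E →+* w.adicCompletion L).injective
  -- dimensions
  have hdimE : Module.finrank (v.adicCompletion K) E = 2 := QuadraticAlgebra.finrank_eq_two a 0
  have hle : Module.finrank (v.adicCompletion K) (w.adicCompletion L) ≤ 2 :=
    hL ▸ finrank_adicCompletion_le K L v w hf hfK
  haveI : FiniteDimensional (v.adicCompletion K) E := Module.finite_of_finrank_pos (by omega)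
  have hrange : Module.finrank (v.adicCompletion K) (LinearMap.range φ.toLinearMap) = 2 := by
    rw [LinearMap.finrank_range_of_inj hinj, hdimE]
  have hdimL : Module.finrank (v.adicCompletion K) (w.adicCompletion L) = 2 :=
    le_antisymm hle (hrange ▸ Submodule.finrank_le _)
  have hsurj : Function.Surjective φ :=
    (LinearMap.injective_iff_surjective_of_finrank_eq_finrank (f := φ.toLinearMap)
      (by rw [hdimE, hdimL])).mp hinj
  refine ⟨(AlgEquiv.ofBijective φ ⟨hinj, hsurj⟩).toRingEquiv, fun x ↦ ?_, ?_⟩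
  · change φ (algebraMap _ E x) = f x
    rw [AlgHom.commutes, RingHom.algebraMap_toAlgebra]
  · change φ QuadraticAlgebra.omega = ω'
    exact hφω

/-- The index of the subgroup of squares is invariant under group isomorphisms. [folklore] -/
theorem index_square_eq_of_mulEquiv {A B : Type*} [CommGroup A] [CommGroup B] (e : A ≃* B) :
    (Subgroup.square B).index = (Subgroup.square A).index := by
  have h : Subgroup.square B = (Subgroup.square A).map (e : A →* B) := by
    ext y
    rw [Subgroup.mem_square, Subgroup.mem_map]
    constructor
    · rintro ⟨s, rfl⟩
      exact ⟨e.symm s * e.symm s, Subgroup.mem_square.mpr ⟨e.symm s, rfl⟩, by simp⟩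
    · rintro ⟨x, hx, rfl⟩
      obtain ⟨t, rfl⟩ := Subgroup.mem_square.mp hx
      exact ⟨e t, by simp⟩
  rw [h, Subgroup.index_map_equiv]

end LocalIso

section IntegerIndex

variable (K : Type*) [Field K] [NumberField K] (v : HeightOneSpectrum (𝓞 K))

/-- For `c ∈ 𝒪_v`, the index of the additive subgroup `c 𝒪_v` in `𝒪_v` (both inside `K_v`) is
`|𝒪_v / c 𝒪_v|`. [folklore] -/
theorem relIndex_map_mulLeft_integer (c : 𝒪[v.adicCompletion K]) :
    ((Valued.integer (v.adicCompletion K)).toAddSubgroup.map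
        (AddMonoidHom.mulLeft (c : v.adicCompletion K))).relIndex
      (Valued.integer (v.adicCompletion K)).toAddSubgroup =
      Nat.card (𝒪[v.adicCompletion K] ⧸ Ideal.span ({c} : Set 𝒪[v.adicCompletion K])) := by
  set ι : 𝒪[v.adicCompletion K] →+ v.adicCompletion K :=
    (Valued.integer (v.adicCompletion K)).subtype.toAddMonoidHom with hι
  set H := (Valued.integer (v.adicCompletion K)).toAddSubgroup.map
    (AddMonoidHom.mulLeft (c : v.adicCompletion K)) with hH
  have hrange : AddSubgroup.map ι ⊤ = (Valued.integer (v.adicCompletion K)).toAddSubgroup := by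
    ext y
    constructor
    · rintro ⟨x, -, rfl⟩
      exact x.2
    · intro hy
      exact ⟨⟨y, hy⟩, trivial, rfl⟩
  have hsub : H.comap ι = (Ideal.span ({c} : Set 𝒪[v.adicCompletion K])).toAddSubgroup := by
    ext x
    rw [AddSubgroup.mem_comap, hH, AddSubgroup.mem_map, Submodule.mem_toAddSubgroup,
      Ideal.mem_span_singleton']
    constructor
    · rintro ⟨y, hy, hyx⟩
      refine ⟨⟨y, hy⟩, Subtype.ext ?_⟩
      rw [AddMonoidHom.coe_mulLeft] at hyx
      rw [Subring.coe_mul, mul_comm]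
      exact hyx
    · rintro ⟨y, rfl⟩
      refine ⟨y, y.2, ?_⟩
      rw [AddMonoidHom.coe_mulLeft, hι]
      change (c : v.adicCompletion K) * y = ((y * c : 𝒪[v.adicCompletion K]) : v.adicCompletion K)
      rw [Subring.coe_mul, mul_comm]
  rw [← hrange, ← AddSubgroup.relIndex_comap, AddSubgroup.relIndex_top_right, hsub,
    AddSubgroup.index_eq_card]
  rfl

end IntegerIndex

section ValuedTwo

/-- `v(2) ≤ 1` for a `ℤᵐ⁰`-valued field (`2 = 1 + 1`). [folklore] -/
theorem valued_two_le_one (F : Type*) [Field F] [Valued F (WithZero (Multiplicative ℤ))] :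
    Valued.v (2 : F) ≤ 1 := by
  rw [show (2 : F) = 1 + 1 by norm_num]
  exact Valuation.map_add_le _ (le_of_eq (Valuation.map_one _)) (le_of_eq (Valuation.map_one _))

end ValuedTwo

section IntegerComparison

open scoped Valued

variable (K L : Type*) [Field K] [NumberField K] [Field L] [NumberField L] [Algebra K L]
variable (v : HeightOneSpectrum (𝓞 K)) (w : HeightOneSpectrum (𝓞 L))

/-- The index of `2𝒪 × 2𝒪` in `𝒪 × 𝒪` (inside `K_v × K_v`) is `|𝒪_v/2𝒪_v|²`. [folklore] -/
theorem relIndex_prod_map_mulLeft_two :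
    (((Valued.integer (v.adicCompletion K)).toAddSubgroup.prod
        (Valued.integer (v.adicCompletion K)).toAddSubgroup).map
        ((AddMonoidHom.mulLeft (2 : v.adicCompletion K)).prodMap
          (AddMonoidHom.mulLeft (2 : v.adicCompletion K)))).relIndex
      ((Valued.integer (v.adicCompletion K)).toAddSubgroup.prod
        (Valued.integer (v.adicCompletion K)).toAddSubgroup) =
      Nat.card (𝒪[v.adicCompletion K] ⧸ Ideal.span {(2 : 𝒪[v.adicCompletion K])}) ^ 2 := by
  set O := (Valued.integer (v.adicCompletion K)).toAddSubgroup with hO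
  set μ₂ := (AddMonoidHom.mulLeft (2 : v.adicCompletion K)).prodMap
    (AddMonoidHom.mulLeft (2 : v.adicCompletion K)) with hμ₂
  set ι : 𝒪[v.adicCompletion K] →+ v.adicCompletion K :=
    (Valued.integer (v.adicCompletion K)).subtype.toAddMonoidHom with hι
  set ι₂ := ι.prodMap ι with hι₂
  set I : AddSubgroup 𝒪[v.adicCompletion K] :=
    (Ideal.span {(2 : 𝒪[v.adicCompletion K])}).toAddSubgroup with hI
  have hι₂_apply : ∀ p q : 𝒪[v.adicCompletion K],
      ι₂ (p, q) = ((p : v.adicCompletion K), (q : v.adicCompletion K)) := fun p q ↦ rfl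
  have hμ₂_apply : ∀ p q : v.adicCompletion K, μ₂ (p, q) = (2 * p, 2 * q) := fun p q ↦ rfl
  have hrange : AddSubgroup.map ι₂ ⊤ = O.prod O := by
    ext ⟨x, y⟩
    constructor
    · rintro ⟨⟨p, q⟩, -, h⟩
      rw [hι₂_apply, Prod.mk.injEq] at h
      obtain ⟨rfl, rfl⟩ := h
      exact ⟨p.2, q.2⟩
    · rintro ⟨hx, hy⟩
      exact ⟨(⟨x, hx⟩, ⟨y, hy⟩), trivial, rfl⟩
  have hmemI : ∀ z : 𝒪[v.adicCompletion K], z ∈ I ↔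
      ∃ t : 𝒪[v.adicCompletion K], (z : v.adicCompletion K) = 2 * t := by
    intro z
    rw [hI, Submodule.mem_toAddSubgroup, Ideal.mem_span_singleton']
    constructor
    · rintro ⟨t, rfl⟩
      exact ⟨t, by rw [Subring.coe_mul, mul_comm]; rfl⟩
    · rintro ⟨t, ht⟩
      refine ⟨t, Subtype.ext ?_⟩
      rw [Subring.coe_mul, mul_comm]
      exact ht.symm
  have hsub : ((O.prod O).map μ₂).comap ι₂ = I.prod I := by
    ext ⟨x, y⟩
    rw [AddSubgroup.mem_comap, AddSubgroup.mem_map, AddSubgroup.mem_prod, hmemI, hmemI]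
    constructor
    · rintro ⟨⟨p, q⟩, ⟨hp, hq⟩, h⟩
      rw [hμ₂_apply, hι₂_apply, Prod.mk.injEq] at h
      exact ⟨⟨⟨p, hp⟩, h.1.symm⟩, ⟨⟨q, hq⟩, h.2.symm⟩⟩
    · rintro ⟨⟨s, hs⟩, ⟨t, ht⟩⟩
      refine ⟨((s : v.adicCompletion K), (t : v.adicCompletion K)), ⟨s.2, t.2⟩, ?_⟩
      rw [hμ₂_apply, hι₂_apply, hs, ht]
  have key := AddSubgroup.relIndex_comap ((O.prod O).map μ₂) ι₂ ⊤
  rw [hrange, AddSubgroup.relIndex_top_right, hsub, AddSubgroup.index_prod] at key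
  rw [← key, hI, AddSubgroup.index_eq_card, sq]
  rfl

/-- **`|𝒪_w / 2𝒪_w| = |𝒪_v / 2𝒪_v|²` for a quadratic completion.** Let `[L : K] = 2`, `r² = a₀`
in `L` with `a₀ ∈ K` integral at `v` and not a square in `K_v`, and `f : K_v →+* L_w` a continuous
extension of `K → L` (`w ∣ v`). Then `L_w = f(K_v) ⊕ f(K_v) r`
(`exists_ringEquiv_quadraticAlgebra_adicCompletion`)
topologically (a linear bijection of finite-dimensional Hausdorff spaces over the complete field
`K_v` is a homeomorphism, Mathlib `LinearEquiv.toContinuousLinearEquiv`), so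
`M = f(𝒪_v) ⊕ f(𝒪_v) r` is an open subgroup of the compact group `𝒪_w`, of finite index; as
multiplication by `2` is injective, `(𝒪_w : 2𝒪_w) = (M : 2M) = (𝒪_v : 2𝒪_v)²`
(`(2M : 2𝒪_w) = (M : 𝒪_w)`). (The classical route is `e f = 2` for `L_w/K_v`; this index
count avoids the ramification theory of local fields missing in Mathlib at the pin.) [folklore] -/
theorem natCard_integer_quotient_two_eq_sq [w.asIdeal.LiesOver v.asIdeal]
    {f : v.adicCompletion K →+* w.adicCompletion L} (hf : Continuous f)
    (hfK : ∀ x : K, f (algebraMap K (v.adicCompletion K) x) =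
      algebraMap L (w.adicCompletion L) (algebraMap K L x))
    (hL : Module.finrank K L = 2) {a₀ : K} {r : L} (hr : r * r = algebraMap K L a₀)
    (ha1 : Valued.v (algebraMap K (v.adicCompletion K) a₀) ≤ 1)
    [Fact (∀ x : v.adicCompletion K, x ^ 2 ≠ algebraMap K (v.adicCompletion K) a₀ + 0 * x)] :
    Nat.card (𝒪[w.adicCompletion L] ⧸ Ideal.span {(2 : 𝒪[w.adicCompletion L])}) =
      Nat.card (𝒪[v.adicCompletion K] ⧸ Ideal.span {(2 : 𝒪[v.adicCompletion K])}) ^ 2 := by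
  -- the `K_v`-module structure on `L_w`
  letI : Algebra (v.adicCompletion K) (w.adicCompletion L) := f.toAlgebra
  haveI : IsScalarTower K (v.adicCompletion K) (w.adicCompletion L) :=
    IsScalarTower.of_algebraMap_eq fun x ↦ by
      rw [RingHom.algebraMap_toAlgebra, hfK, ← IsScalarTower.algebraMap_apply]
  haveI : ContinuousSMul (v.adicCompletion K) (w.adicCompletion L) :=
    ⟨(hf.comp continuous_fst).mul continuous_snd⟩
  -- the local isomorphism and `ω' = r`
  obtain ⟨e, he, heω⟩ := exists_ringEquiv_quadraticAlgebra_adicCompletion K L v w hf hfK hL hr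
  set ω' : w.adicCompletion L := algebraMap L (w.adicCompletion L) r with hω'
  have hω'sq : ω' * ω' = f (algebraMap K (v.adicCompletion K) a₀) := by
    rw [hω', ← map_mul, hr, hfK]
  -- valuations: `f 𝒪_v ⊆ 𝒪_w`, `ω' ∈ 𝒪_w`
  have hfint : ∀ x : v.adicCompletion K, Valued.v x ≤ 1 → Valued.v (f x) ≤ 1 := fun x hx ↦
    valued_le_one_of_ringHom K L v w hf hfK hx
  have hω'1 : Valued.v ω' ≤ 1 := by
    by_contra h
    push Not at h
    have h2 : 1 < Valued.v (ω' * ω') := by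
      rw [map_mul]; exact one_lt_mul'' h h
    rw [hω'sq] at h2
    exact absurd (hfint _ ha1) (not_le.mpr h2)
  -- the linear bijection `T (p, q) = f p + f q ω' = e ⟨p, q⟩`
  let T : (v.adicCompletion K × v.adicCompletion K) →ₗ[v.adicCompletion K] w.adicCompletion L :=
    { toFun := fun pq ↦ f pq.1 + f pq.2 * ω'
      map_add' := fun x y ↦ by simp only [Prod.fst_add, Prod.snd_add, map_add]; ring
      map_smul' := fun c x ↦ by
        change f (c • x).1 + f (c • x).2 * ω' = c • (f x.1 + f x.2 * ω')
        rw [Prod.smul_fst, Prod.smul_snd, smul_eq_mul, smul_eq_mul, map_mul, map_mul,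
          Algebra.smul_def, RingHom.algebraMap_toAlgebra]
        ring }
  have hT : ∀ p q, T (p, q) = f p + f q * ω' := fun p q ↦ rfl
  have hTe : ∀ p q : v.adicCompletion K, T (p, q) = e ⟨p, q⟩ := by
    intro p q
    have hpq : (⟨p, q⟩ : QuadraticAlgebra (v.adicCompletion K)
        (algebraMap K (v.adicCompletion K) a₀) 0) =
        algebraMap (v.adicCompletion K) _ p + algebraMap (v.adicCompletion K) _ q *
          QuadraticAlgebra.omega := by
      ext <;> simp [QuadraticAlgebra.algebraMap_eq, QuadraticAlgebra.omega]
    rw [hT, hpq, map_add, map_mul, he, he, heω]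
  have hTinj : Function.Injective T := by
    rintro ⟨p, q⟩ ⟨p', q'⟩ h
    rw [hTe, hTe] at h
    have h' := e.injective h
    simp only [QuadraticAlgebra.mk.injEq] at h'
    rw [h'.1, h'.2]
  have hTsurj : Function.Surjective T := by
    intro y
    obtain ⟨z, rfl⟩ := e.surjective y
    exact ⟨(z.re, z.im), by rw [hTe]⟩
  let Tc : (v.adicCompletion K × v.adicCompletion K) ≃L[v.adicCompletion K] w.adicCompletion L :=
    (LinearEquiv.ofBijective T ⟨hTinj, hTsurj⟩).toContinuousLinearEquiv
  have hTc : ∀ x, Tc x = T x := fun x ↦ rfl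
  -- the subgroups
  set O := (Valued.integer (v.adicCompletion K)).toAddSubgroup with hO
  set A := (Valued.integer (w.adicCompletion L)).toAddSubgroup with hA
  set M := (O.prod O).map (Tc : (v.adicCompletion K × v.adicCompletion K) →+ w.adicCompletion L)
    with hM
  have hmemO : ∀ x, x ∈ O ↔ Valued.v x ≤ 1 := fun x ↦ Valuation.mem_integer_iff _ _
  have hmemA : ∀ x, x ∈ A ↔ Valued.v x ≤ 1 := fun x ↦ Valuation.mem_integer_iff _ _
  have hM_le : M ≤ A := by
    rintro _ ⟨⟨p, q⟩, ⟨hp, hq⟩, rfl⟩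
    rw [hmemA]
    change Valued.v (Tc (p, q)) ≤ 1
    rw [hTc, hT]
    exact Valuation.map_add_le _ (hfint p ((hmemO p).mp hp))
      (by rw [map_mul]; exact mul_le_one' (hfint q ((hmemO q).mp hq)) hω'1)
  have hM_open : IsOpen (M : Set (w.adicCompletion L)) := by
    rw [hM, AddSubgroup.coe_map]
    exact Tc.toHomeomorph.isOpenMap _
      ((Valued.isOpen_integer (v.adicCompletion K)).prod (Valued.isOpen_integer _))
  -- `M` has finite index in the compact `𝒪_w`
  have hMA : M.relIndex A ≠ 0 := by
    haveI : CompactSpace 𝒪[w.adicCompletion L] :=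
      Literature.NumberTheory.Automorphic.compactSpace_integer_adicCompletion L w
    haveI : CompactSpace A := inferInstanceAs (CompactSpace 𝒪[w.adicCompletion L])
    have hopen : IsOpen ((M.addSubgroupOf A : AddSubgroup A) : Set A) := by
      rw [AddSubgroup.coe_addSubgroupOf]
      exact hM_open.preimage continuous_subtype_val
    haveI := AddSubgroup.quotient_finite_of_isOpen _ hopen
    exact AddSubgroup.index_ne_zero_of_finite
  -- multiplication by `2`
  set μ : w.adicCompletion L →+ w.adicCompletion L :=
    AddMonoidHom.mulLeft (((2 : 𝒪[w.adicCompletion L]) : w.adicCompletion L)) with hμ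
  set μ₂ := (AddMonoidHom.mulLeft (2 : v.adicCompletion K)).prodMap
    (AddMonoidHom.mulLeft (2 : v.adicCompletion K)) with hμ₂
  have hμ_apply : ∀ y, μ y = 2 * y := fun y ↦ by rw [hμ, AddMonoidHom.coe_mulLeft]; rfl
  have hv2K : Valued.v (2 : v.adicCompletion K) ≤ 1 := valued_two_le_one _
  have hv2L : Valued.v (2 : w.adicCompletion L) ≤ 1 := valued_two_le_one _
  haveI : CharZero (w.adicCompletion L) :=
    charZero_of_injective_algebraMap (algebraMap L _).injective
  have hμ_inj : Function.Injective μ := fun x y h ↦ by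
    rw [hμ_apply, hμ_apply] at h
    exact mul_left_cancel₀ two_ne_zero h
  -- `2 M = Tc (2 (O × O))`
  have hcomm : μ.comp (Tc : (v.adicCompletion K × v.adicCompletion K) →+ w.adicCompletion L) =
      (Tc : (v.adicCompletion K × v.adicCompletion K) →+ w.adicCompletion L).comp μ₂ := by
    refine AddMonoidHom.ext fun pq ↦ ?_
    obtain ⟨p, q⟩ := pq
    change μ (Tc (p, q)) = Tc (μ₂ (p, q))
    rw [hμ_apply, hTc, hTc]
    change 2 * T (p, q) = T (2 * p, 2 * q)
    rw [hT, hT, map_mul, map_mul, map_ofNat]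
    ring
  have hμM : M.map μ = ((O.prod O).map μ₂).map
      (Tc : (v.adicCompletion K × v.adicCompletion K) →+ w.adicCompletion L) := by
    rw [hM, AddSubgroup.map_map, hcomm, ← AddSubgroup.map_map]
  have hO2 : (O.prod O).map μ₂ ≤ O.prod O := by
    rintro _ ⟨⟨p, q⟩, ⟨hp, hq⟩, rfl⟩
    change (2 * p, 2 * q) ∈ O.prod O
    refine ⟨(hmemO _).mpr ?_, (hmemO _).mpr ?_⟩
    · rw [map_mul]; exact mul_le_one' hv2K ((hmemO p).mp hp)
    · rw [map_mul]; exact mul_le_one' hv2K ((hmemO q).mp hq)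
  have hμM_le : M.map μ ≤ M := by
    rw [hμM, hM]; exact AddSubgroup.map_mono hO2
  have hμA_le : A.map μ ≤ A := by
    rintro _ ⟨y, hy, rfl⟩
    rw [hmemA, hμ_apply, map_mul]
    exact mul_le_one' hv2L ((hmemA y).mp hy)
  -- the index identities
  have h1 := AddSubgroup.relIndex_mul_relIndex (M.map μ) (A.map μ) A
    (AddSubgroup.map_mono hM_le) hμA_le
  have h2 := AddSubgroup.relIndex_mul_relIndex (M.map μ) M A hμM_le hM_le
  have h3 : (M.map μ).relIndex (A.map μ) = M.relIndex A :=
    AddSubgroup.relIndex_map_map_of_injective _ _ hμ_inj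
  have h4 : (A.map μ).relIndex A =
      Nat.card (𝒪[w.adicCompletion L] ⧸ Ideal.span {(2 : 𝒪[w.adicCompletion L])}) :=
    relIndex_map_mulLeft_integer L w 2
  have h5 : (M.map μ).relIndex M =
      Nat.card (𝒪[v.adicCompletion K] ⧸ Ideal.span {(2 : 𝒪[v.adicCompletion K])}) ^ 2 := by
    rw [hμM, hM, AddSubgroup.relIndex_map_map_of_injective _ _ Tc.injective]
    exact relIndex_prod_map_mulLeft_two K v
  -- `M.relIndex A * (A.map μ).relIndex A = (M.map μ).relIndex M * M.relIndex A`
  have key : M.relIndex A * (A.map μ).relIndex A = (M.map μ).relIndex M * M.relIndex A :=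
    calc M.relIndex A * (A.map μ).relIndex A
        = (M.map μ).relIndex (A.map μ) * (A.map μ).relIndex A := by rw [h3]
      _ = (M.map μ).relIndex A := h1
      _ = (M.map μ).relIndex M * M.relIndex A := h2.symm
  rw [← h4, ← h5]
  exact mul_left_cancel₀ hMA (key.trans (mul_comm _ _))

end IntegerComparison

/-! ### The local norm index is `2` at every place -/

section NormIndex

open scoped Valued

variable (K : Type) [Field K] [NumberField K] (v : HeightOneSpectrum (𝓞 K))

/-- Rescaling `a` by a non-zero square does not change the norm group `N(K_v(√a))`. [folklore] -/
theorem quadraticNormSubgroup_mul_sq {F : Type*} [Field F] (a : F) {c : F} (hc : c ≠ 0) :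
    quadraticNormSubgroup F (a * c ^ 2) = quadraticNormSubgroup F a := by
  ext t
  rw [mem_quadraticNormSubgroup_iff, mem_quadraticNormSubgroup_iff]
  constructor
  · rintro ⟨x, y, h⟩
    exact ⟨x, c * y, by rw [← h]; ring⟩
  · rintro ⟨x, y, h⟩
    exact ⟨x, y / c, by rw [← h]; field_simp⟩

/-- **Global integral representatives of local square classes.** Every `a ∈ K_vˣ` is
`a = b c²` with `b ∈ K` global, `v(b) ≤ 1`, and `c ∈ K_vˣ`: normalise the valuation of `a` to
`0` or `-1` by an even power of a global uniformiser, then replace the result `a'` by a global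
`b` with `b/a' ≡ 1 (mod 4π)`, a square by Hensel (`map_powMonoidHom_two_congr`:
`1 + 4π𝒪_v = (1 + 2π𝒪_v)²`), using the density of `K` in `K_v`. (O'Meara 63:1, the Local
Square Theorem, in the form needed here.) [folklore] -/
theorem exists_eq_algebraMap_mul_sq (a : v.adicCompletion K) (ha : a ≠ 0) :
    ∃ (b : K) (c : v.adicCompletion K), c ≠ 0 ∧ Valued.v (algebraMap K (v.adicCompletion K) b) ≤ 1 ∧
      a = algebraMap K (v.adicCompletion K) b * c ^ 2 := by
  haveI : IsDiscreteValuationRing 𝒪[v.adicCompletion K] :=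
    inferInstanceAs (IsDiscreteValuationRing (v.adicCompletionIntegers K))
  -- a global uniformiser `ϖ`
  obtain ⟨π₀, hπ₀⟩ := v.valuation_exists_uniformizer K
  set ϖ : v.adicCompletion K := algebraMap K (v.adicCompletion K) π₀ with hϖdef
  have hϖ : Valued.v ϖ = WithZero.exp (-1) := by
    have hval : Valued.v ϖ = v.valuation K π₀ :=
      HeightOneSpectrum.valuedAdicCompletion_eq_valuation' v π₀
    rw [hval, hπ₀]
  have hϖ0 : ϖ ≠ 0 := by
    intro h; rw [h, map_zero] at hϖ; exact WithZero.coe_ne_zero hϖ.symm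
  -- normalise the valuation: `a' = a ϖ^{2k}` with `v(a') = exp(-r)`, `r ∈ {0, 1}`
  set n : ℤ := WithZero.log (Valued.v a) with hn
  have ha_v : Valued.v a = WithZero.exp n :=
    (WithZero.exp_log ((Valuation.ne_zero_iff _).2 ha)).symm
  set k : ℤ := -((-n) / 2) with hk
  set r : ℤ := (-n) % 2 with hr
  have hr01 : r = 0 ∨ r = 1 := by
    have h0 : 0 ≤ r := Int.emod_nonneg _ two_ne_zero
    have h1 : r < 2 := Int.emod_lt_of_pos _ two_pos
    omega
  have hnk : n - 2 * k = -r := by omega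
  set a' : v.adicCompletion K := a * ϖ ^ (2 * k) with ha'
  have ha'_v : Valued.v a' = WithZero.exp (-r) := by
    rw [ha', map_mul, map_zpow₀, ha_v, hϖ, ← WithZero.exp_zsmul, smul_eq_mul, ← WithZero.exp_add,
      ← hnk]
    ring_nf
  have ha'0 : a' ≠ 0 := mul_ne_zero ha (zpow_ne_zero _ hϖ0)
  have ha'1 : Valued.v a' ≤ 1 := by
    rw [ha'_v, ← WithZero.exp_zero, WithZero.exp_le_exp]
    omega
  -- an irreducible `π ∈ 𝒪_v` and the radius `v(4 π a')`
  obtain ⟨π, hπ⟩ := IsDiscreteValuationRing.exists_irreducible 𝒪[v.adicCompletion K]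
  have hπ0 : (π : v.adicCompletion K) ≠ 0 := by
    intro h; exact hπ.ne_zero (Subtype.ext h)
  haveI : CharZero (v.adicCompletion K) :=
    charZero_of_injective_algebraMap (algebraMap K _).injective
  have h4π : (4 * (π : v.adicCompletion K)) ≠ 0 := mul_ne_zero (by norm_num) hπ0
  set γ := Valued.v (4 * (π : v.adicCompletion K) * a') with hγ
  -- density: a global `b` with `v(b - a') < γ`
  have hnhds : {y : v.adicCompletion K | Valued.v (y - a') < γ} ∈ nhds a' := by
    rw [Valued.mem_nhds]
    have h' : Valued.v.restrict (4 * (π : v.adicCompletion K) * a') ≠ 0 := by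
      simp [hπ.ne_zero, ha'0]
    refine ⟨Units.mk0 _ h', fun y hy ↦ ?_⟩
    rw [Set.mem_setOf_eq, Units.val_mk0] at hy
    exact Valued.v.restrict_lt_iff.mp hy
  obtain ⟨_, ⟨hyball, ⟨b, rfl⟩⟩⟩ :=
    mem_closure_iff_nhds.mp (HeightOneSpectrum.denseRange_algebraMap (K := K) v a') _ hnhds
  -- `q = b / a'` satisfies `q = 1 + 4π t` with `t ∈ 𝒪_v`
  set q : v.adicCompletion K := algebraMap K (v.adicCompletion K) b / a' with hq
  have hq1 : Valued.v (q - 1) < Valued.v (4 * (π : v.adicCompletion K)) := by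
    have : q - 1 = (algebraMap K (v.adicCompletion K) b - a') / a' := by
      rw [hq]; field_simp
    rw [this, map_div₀, div_lt_iff₀ (by rwa [Valuation.pos_iff]), ← map_mul]
    exact hyball
  set t : v.adicCompletion K := (q - 1) / (4 * π) with ht
  have ht1 : Valued.v t ≤ 1 := by
    rw [ht, map_div₀, div_le_one₀ (by rwa [Valuation.pos_iff])]
    exact hq1.le
  have hqt : q = 1 + 4 * π * t := by rw [ht]; field_simp; ring
  -- `q` is a unit of `𝒪_v` in `1 + 4π𝒪_v`, hence a square
  have hv4 : Valued.v (4 : v.adicCompletion K) ≤ 1 := by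
    rw [show (4 : v.adicCompletion K) = 2 * 2 by norm_num, map_mul]
    exact mul_le_one' (valued_two_le_one _) (valued_two_le_one _)
  have hq_v : Valued.v q = 1 := by
    have h1 : Valued.v (q - 1) < 1 := by
      refine hq1.trans_le ?_
      rw [map_mul]
      exact mul_le_one' hv4 π.2
    rw [show q = 1 + (q - 1) by ring]
    exact Valuation.map_one_add_of_lt _ h1
  have hqu : IsUnit (⟨q, hq_v.le⟩ : 𝒪[v.adicCompletion K]) := (isUnit_integer_iff K v _).mpr hq_v
  set qO : (𝒪[v.adicCompletion K])ˣ := hqu.unit with hqO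
  have hqO_mem : qO ∈ (Units.map ((Ideal.Quotient.mk (Ideal.span {4 * π})).toMonoidHom)).ker := by
    rw [mem_ker_unitsMap_mk_span_iff]
    refine ⟨⟨t, ht1⟩, Subtype.ext ?_⟩
    rw [hqO, IsUnit.unit_spec]
    change q = ((1 + 4 * π * ⟨t, ht1⟩ : 𝒪[v.adicCompletion K]) : v.adicCompletion K)
    push_cast
    exact hqt
  rw [← map_powMonoidHom_two_congr K v π hπ] at hqO_mem
  obtain ⟨w₀, -, hw₀⟩ := hqO_mem
  have hq_sq : q = (((w₀ : 𝒪[v.adicCompletion K]) : v.adicCompletion K)) ^ 2 := by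
    have h := congrArg
      (fun u : (𝒪[v.adicCompletion K])ˣ ↦ ((u : 𝒪[v.adicCompletion K]) : v.adicCompletion K)) hw₀
    simp only [powMonoidHom_apply, Units.val_pow_eq_pow_val, Subring.coe_pow] at h
    rw [h, hqO, IsUnit.unit_spec]
  have hw₀0 : (((w₀ : 𝒪[v.adicCompletion K]) : v.adicCompletion K)) ≠ 0 := by
    intro h0
    have : q = 0 := by rw [hq_sq, h0]; ring
    rw [this, map_zero] at hq_v
    exact zero_ne_one hq_v
  -- assemble: `a = b · (w₀ ϖ^k)⁻²`
  set c : v.adicCompletion K := ((((w₀ : 𝒪[v.adicCompletion K]) : v.adicCompletion K)) * ϖ ^ k)⁻¹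
    with hc
  have hc0 : c ≠ 0 := inv_ne_zero (mul_ne_zero hw₀0 (zpow_ne_zero _ hϖ0))
  have hb : algebraMap K (v.adicCompletion K) b = q * a' := by
    rw [hq, div_mul_cancel₀ _ ha'0]
  refine ⟨b, c, hc0, ?_, ?_⟩
  · rw [hb, map_mul, hq_v, one_mul]; exact ha'1
  · set W : v.adicCompletion K := ((w₀ : 𝒪[v.adicCompletion K]) : v.adicCompletion K) with hW
    have hsq : c ^ 2 = (W ^ 2 * ϖ ^ (2 * k))⁻¹ := by
      rw [hc, inv_pow, mul_pow, ← zpow_natCast (ϖ ^ k) 2, ← zpow_mul, mul_comm k]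
      norm_num
    have hne : W ^ 2 * ϖ ^ (2 * k) ≠ 0 := mul_ne_zero (pow_ne_zero _ hw₀0) (zpow_ne_zero _ hϖ0)
    rw [hb, hq_sq, ha', hsq, show W ^ 2 * (a * ϖ ^ (2 * k)) = a * (W ^ 2 * ϖ ^ (2 * k)) by ring,
      mul_inv_cancel_right₀ hne]

/-- **The local norm index is `2` for a global integral non-square.** For `b ∈ K` with `v(b) ≤ 1`
not a square in `K_v`: `(K_vˣ : N(K_v(√b)ˣ)) = 2`. The counting identity
(`index_quadraticNormSubgroup_mul_two_mul_index_square`) with `(K_vˣ : K_vˣ²) = 4q`,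
`(Eˣ : Eˣ²) = 4q²` (`q = |𝒪_v/2𝒪_v|`), where `E = K_v(√b) ≃ L_w` for `L = K(√b)` and `w ∣ v`
(`exists_ringEquiv_quadraticAlgebra_adicCompletion`), O'Meara 63:9 at `v` and `w`
(`index_square_eq_four_mul_natCard`) and `|𝒪_w/2𝒪_w| = q²` (`natCard_integer_quotient_two_eq_sq`).
[cite: Omeara1963, §63B Cor. 63:13a] -/
theorem index_quadraticNormSubgroup_eq_two_of_algebraMap {b : K}
    (hb : ¬ IsSquare (algebraMap K (v.adicCompletion K) b))
    (hb1 : Valued.v (algebraMap K (v.adicCompletion K) b) ≤ 1) :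
    (quadraticNormSubgroup (v.adicCompletion K)
      (algebraMap K (v.adicCompletion K) b)).index = 2 := by
  haveI : CharZero (v.adicCompletion K) :=
    charZero_of_injective_algebraMap (algebraMap K _).injective
  -- the local and global quadratic fields
  haveI hFv := Literature.NumberTheory.Automorphic.fact_sq_ne_of_not_isSquare (v.adicCompletion K) _ hb
  have hbK : ¬ IsSquare b := fun ⟨s, hs⟩ ↦ hb ⟨algebraMap K _ s, by rw [hs, map_mul]⟩
  haveI hFK := Literature.NumberTheory.Automorphic.fact_sq_ne_of_not_isSquare K b hbK
  haveI := Literature.NumberTheory.Automorphic.QuadraticAlgebra.numberField K b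
  set L := QuadraticAlgebra K b 0 with hL
  -- a place `w` of `L` over `v`
  obtain ⟨Q, hQmax, hQover⟩ :=
    Ideal.exists_maximal_ideal_liesOver_of_isIntegral (S := 𝓞 L) v.asIdeal
  have hQ0 : Q ≠ ⊥ := by
    intro h0
    apply v.ne_bot
    rw [hQover.over, h0, Ideal.under_bot]
  let w : HeightOneSpectrum (𝓞 L) := ⟨Q, hQmax.isPrime, hQ0⟩
  haveI : w.asIdeal.LiesOver v.asIdeal := hQover
  -- the completion map and the inputs
  obtain ⟨f, hf, hfK⟩ := exists_continuous_ringHom_adicCompletion K L v w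
  have hfin : Module.finrank K L = 2 := QuadraticAlgebra.finrank_eq_two b 0
  have hω : (QuadraticAlgebra.omega : L) * QuadraticAlgebra.omega = algebraMap K L b :=
    Literature.NumberTheory.Automorphic.QuadraticAlgebra.omega_mul_omega_eq_algebraMap K b
  obtain ⟨e, -, -⟩ := exists_ringEquiv_quadraticAlgebra_adicCompletion K L v w hf hfK hfin hω
  have hC := natCard_integer_quotient_two_eq_sq K L v w hf hfK hfin hω hb1
  have hPv := index_square_eq_four_mul_natCard K v
  have hPw := index_square_eq_four_mul_natCard L w
  have hR := index_quadraticNormSubgroup_mul_two_mul_index_square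
    (F := v.adicCompletion K) (a := algebraMap K (v.adicCompletion K) b) hb
  have hE : (Subgroup.square (QuadraticAlgebra (v.adicCompletion K)
      (algebraMap K (v.adicCompletion K) b) 0)ˣ).index =
        (Subgroup.square (w.adicCompletion L)ˣ).index :=
    (index_square_eq_of_mulEquiv (Units.mapEquiv e.toMulEquiv)).symm
  -- `q = |𝒪_v / 2𝒪_v| ≠ 0`
  haveI := finite_quotient_span_singleton K v (two_ne_zero_integer K v)
  have hq0 : Nat.card (𝒪[v.adicCompletion K] ⧸ Ideal.span {(2 : 𝒪[v.adicCompletion K])}) ≠ 0 :=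
    Nat.card_pos.ne'
  set q := Nat.card (𝒪[v.adicCompletion K] ⧸ Ideal.span {(2 : 𝒪[v.adicCompletion K])}) with hq
  set N := (quadraticNormSubgroup (v.adicCompletion K) (algebraMap K (v.adicCompletion K) b)).index
  -- `N * (2 * 4 q²) = (4 q)²`
  rw [hE, hPw, hC, hPv] at hR
  have h16 : N * (8 * q ^ 2) = 2 * (8 * q ^ 2) := by linear_combination hR
  exact mul_right_cancel₀ (by positivity) h16

/-- **O'Meara 63:13a at every finite place, without class field theory**: for a number field
`K`, a finite place `v` (dyadic or not) and a non-square `a ∈ K_vˣ`, the norm group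
`N(K_v(√a)ˣ) = quadraticNormSubgroup K_v a` has index `2` in `K_vˣ`. Reduce to a global integral
representative of the square class of `a` (`exists_eq_algebraMap_mul_sq`,
`quadraticNormSubgroup_mul_sq`) and apply `index_quadraticNormSubgroup_eq_two_of_algebraMap`.
[cite: Omeara1963, §63B Cor. 63:13a] -/
theorem index_quadraticNormSubgroup_adicCompletion_eq_two {a : v.adicCompletion K} (ha0 : a ≠ 0)
    (ha : ¬ IsSquare a) : (quadraticNormSubgroup (v.adicCompletion K) a).index = 2 := by
  obtain ⟨b, c, hc0, hb1, rfl⟩ := exists_eq_algebraMap_mul_sq K v a ha0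
  rw [quadraticNormSubgroup_mul_sq _ hc0]
  refine index_quadraticNormSubgroup_eq_two_of_algebraMap K v (fun ⟨s, hs⟩ ↦ ha ?_) hb1
  exact ⟨s * c, by rw [hs]; ring⟩

end NormIndex

end Literature.NumberTheory.QuadraticForms

/-! ### Consequences: O'Meara 63:13, Vignéras II Thm. 1.1, III Thm. 3.1 from Hasse's norm theorem -/

section Consequences

open NumberField IsDedekindDomain

/-- **O'Meara 63:13 holds**: the named fact `adicCompletion_exists_hilbertSymbol_eq_neg_one K` of
`QuadraticNormIndex.lean` — for a non-square `β ∈ K_v` some `α ∈ K_vˣ` has `(α, β)_v = -1` —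
follows from the norm index `2` (`index_quadraticNormSubgroup_adicCompletion_eq_two`): the norm
group is a proper subgroup. [cite: Omeara1963, §63B Prop. 63:13] -/
theorem Literature.NumberTheory.QuadraticForms.adicCompletion_exists_hilbertSymbol_eq_neg_one_holds (K : Type) [Field K]
    [NumberField K] : Literature.NumberTheory.QuadraticForms.adicCompletion_exists_hilbertSymbol_eq_neg_one K := by
  intro v β hβ0 hβ
  haveI : CharZero (v.adicCompletion K) :=
    charZero_of_injective_algebraMap (algebraMap K _).injective
  obtain ⟨t, ht0, ht⟩ := Literature.NumberTheory.Automorphic.exists_not_isNormFromSqrt_of_index_eq_two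
    (Literature.NumberTheory.QuadraticForms.index_quadraticNormSubgroup_adicCompletion_eq_two K v hβ0 hβ)
  refine ⟨t, ht0, (Literature.NumberTheory.QuadraticForms.hilbertSymbol_eq_neg_one_iff_not_mem_quadraticNormSubgroup hβ0
    (Units.mk0 t ht0)).mpr fun hmem ↦ ht ?_⟩
  exact (Literature.NumberTheory.Automorphic.mk0_mem_quadraticNormSubgroup_iff ht0).mp hmem

universe u v

/-- **Vignéras II §1 Thm. 1.1 holds**: the named fact `nonempty_algEquiv_adicCompletion_of_division`
of `QuaternionAlgebraClassification` — two quaternion division algebras over a completion `K_v` of a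
number field at a finite place are isomorphic — by
`nonempty_algEquiv_adicCompletion_of_division_of_index_eq_two` (`QuaternionAlgebraLocalUniqueness`)
and the local norm index `index_quadraticNormSubgroup_adicCompletion_eq_two`.
[cite: VignerasLNM800, Ch. II §1 Thm. 1.1] -/
theorem Literature.NumberTheory.QuadraticForms.nonempty_algEquiv_adicCompletion_of_division_holds :
    Literature.NumberTheory.Automorphic.nonempty_algEquiv_adicCompletion_of_division.{u, v} :=
  Literature.NumberTheory.Automorphic.nonempty_algEquiv_adicCompletion_of_division_of_index_eq_two
    fun K _ _ v _ hx hxsq ↦ Literature.NumberTheory.QuadraticForms.index_quadraticNormSubgroup_adicCompletion_eq_two K v hx hxsq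

/-- **Vignéras III §3 Thm. 3.8 (1) from Hasse's norm theorem**: the named fact
`exists_sq_eq_of_not_isSquare_ramified K D` of `QuaternionAlgebraEmbedding` follows from Hasse's
norm theorem for the quadratic extensions of `K` (`hilbertSymbol_eq_one_of_forall_completions`,
III Cor. 3.4), the local norm indices in `exists_sq_eq_of_not_isSquare_ramified_of_facts`
(`QuaternionAlgebraEmbeddingProofs`) being now proved.
[cite: VignerasLNM800, Ch. III §3 Thm. 3.8] -/
theorem Literature.NumberTheory.QuadraticForms.exists_sq_eq_of_not_isSquare_ramified_of_hasseNorm (K : Type) [Field K]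
    [NumberField K] (D : Type u) [Ring D] [Algebra K D]
    (hN : ∀ (L : Type) [Field L] [NumberField L] [Algebra K L] (c d : L),
      Literature.NumberTheory.Automorphic.hilbertSymbol_eq_one_of_forall_completions L c d) :
    Literature.NumberTheory.Automorphic.exists_sq_eq_of_not_isSquare_ramified K D :=
  Literature.NumberTheory.Automorphic.exists_sq_eq_of_not_isSquare_ramified_of_facts K D
    (fun v _ _ hx hxsq ↦ Literature.NumberTheory.QuadraticForms.index_quadraticNormSubgroup_adicCompletion_eq_two K v hx hxsq) hN

/-- **Vignéras III §3 Thm. 3.1 (uniqueness) from Hasse's norm theorem alone.** The named fact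
`nonempty_algEquiv_of_ramifiedPlaces_eq K D` of `QuaternionAlgebraAdelic` — two quaternion
algebras over the number field `K` with the same finite and infinite ramification are
isomorphic — follows from Hasse's norm theorem for quadratic extensions of number fields
(`hilbertSymbol_eq_one_of_forall_completions`, III Cor. 3.4; global class field theory, not in
Mathlib). Every other input of the book's proof — Frobenius, base change, Wedderburn, I Cor. 2.2
and 2.4, II Thm. 1.1 (the local theory, through O'Meara 63:9 and 63:13a), III Lemme 3.6,
Cor. 3.5, Thm. 3.8, the finiteness of ramification, and all assemblies — is proved in this file
and its imports. [cite: VignerasLNM800, Ch. III §3 Thm. 3.1] -/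
theorem Literature.NumberTheory.QuadraticForms.nonempty_algEquiv_of_ramifiedPlaces_eq_of_hasseNorm (K : Type) [Field K]
    [NumberField K] (D : Type u) [Ring D] [Algebra K D]
    (hN : ∀ (L : Type) [Field L] [NumberField L] (c d : L),
      Literature.NumberTheory.Automorphic.hilbertSymbol_eq_one_of_forall_completions L c d) :
    Literature.NumberTheory.Automorphic.nonempty_algEquiv_of_ramifiedPlaces_eq.{u, v} K D :=
  Literature.NumberTheory.Automorphic.nonempty_algEquiv_of_ramifiedPlaces_eq_of_index_eq_two_of_hasseNorm K D
    (fun K _ _ v _ hx hxsq ↦ Literature.NumberTheory.QuadraticForms.index_quadraticNormSubgroup_adicCompletion_eq_two K v hx hxsq) hN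

end Consequences
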